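import Mathlib
import Summits.NavierStokesRegularity.NavierStokesRegularity.Theorems.EulerZoomLiouvillePowerGaugeEulerLiouvilleSelfSimilarNonVorticalBadNode
import HarnessLib

/-!
# Rung C1 of the crux `EulerZoomLiouville.PowerGaugeEulerLiouville`: thin stagnation points with a DEFECTIVE
# (non-semisimple) linearisation (route №10, item stmt-NavierStokesRegularity-19832; `--supports`)

Helper file (theorems only). Seat ns-typeII-p3 (cell ns-regularity-ideate §B, D-0081).  Sequel to
`…SelfSimilarSaddleContinuumPlane` / `…SelfSimilarNonVorticalBadNode`.  The two thin shapes landed so far (a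
dominated contracting LINE, a dominated contracting PLANE) are stated for a real BLOCK basis of `A = DW(z) = γI + DV(z)`,
i.e. for a semisimple linearisation.  At a VORTICAL stagnation point the spectrum of `A` is `{1+γ} ∪ {roots of
X² − (2γ−1)X + c}` and the quadratic factor may have a DOUBLE root, or a root equal to `1+γ`, with a Jordan block.
This file supplies the two missing shapes, with no basis at all — the splitting is by kernels of polynomials in `A`
and the rates come from the order-two truncation of the exponential series:

* `exp_smul_apply_of_sq_sub_eq_zero` — `(A − μ)²x = 0 ⇒ e^{tA}x = e^{tμ}(x + t(A − μ)x)` (real form of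
  `Literature.Analysis.ODE.exp_smul_apply_of_pow_sub_eq_zero`, `k = 2`), with the two-sided rates
  `‖x‖/(1 + t‖N‖) ≤ ‖x + tNx‖ ≤ (1 + t‖N‖)‖x‖` (`N = A − μ`, `N²x = 0`, `t ≥ 0`);
* `exists_trappedSet_null_of_rates` — the passage «rates for `e^{TA}` on an `A`-invariant complementary pair
  `Es ⊕ Ec`, `Ec ≠ ⊤`, `a < 1`, `a < b` ⇒ null `Φ_T`-trapped set near `z`» isolated once and for all
  (`D(Φ_T)(z) = e^{TA}` + the dominated cone lemma `hausdorffMeasure_localTrappedSet_eq_zero_of_dominated`);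
* **`exists_trappedSet_null_of_eigenline_lt_doubleRoot`** — `A v₁ = r₁v₁`, `v₁ ≠ 0`, `r₁ < 0`, `r₁ < λ₁`,
  `(A − r₁)(A − λ₁)² = 0` ⇒ null trapped set (`Es = ker(A − r₁)`, `Ec = ker(A − λ₁)²`, rates `e^{r₁T}` versus
  `e^{λ₁T}/(1 + T‖A − λ₁‖)`);
* **`exists_trappedSet_null_of_doubleRoot_lt_eigenline`** — `r₁ < 0`, `r₁ < λ₁`, `A ≠ λ₁I`, `(A − λ₁)(A − r₁)² = 0`
  ⇒ null trapped set (`Es = ker(A − r₁)²`, `Ec = ker(A − λ₁)`, rates `e^{r₁T}(1 + T‖A − r₁‖)` versus `e^{λ₁T}`).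

In both, `Es ⊕ Ec` is the explicit Bézout decomposition `x = c⁻¹M²x + (x − c⁻¹M²x)`, `c = (r₁ − λ₁)²`, and the
sampling time comes from `1 + Tm < e^{κT}` (`exists_one_add_mul_lt_exp`, via `1 + x + x²/2 ≤ eˣ`).  Consumer: the
next file of the seat, «every vortical stagnation point is thin» (spectral case analysis of `A` at a vortical node).

WHAT THIS IS NOT: not NS, not E, not rung C1 — linear algebra of `e^{TA}` and the cone lemma at one stagnation
point; no profile equation is used here. [folklore; cf. Robinson1999 Ch. V §5.10.1; Khalil2002 §4.3 (4.11)]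
-/

noncomputable section

-- flat `Theorems/<Route><Decl>…` files of one crux share the namespace of the crux (tree convention)
set_option linter.dupNamespace false

open MeasureTheory Set Filter Topology Metric Function InnerProductSpace
open scoped RealInnerProductSpace NNReal ContDiff

namespace Summit.NavierStokesRegularity.NavierStokesRegularity.Theorems.PowerGaugeEulerLiouville.Kelvin

open Literature.Analysis Literature.Analysis.FluidPDE Literature.Dynamics.FixedPoints

/-! ### The exponential on a generalized eigenvector of order two (real form) -/

section OrderTwo

variable {F : Type*} [NormedAddCommGroup F] [NormedSpace ℝ F] [CompleteSpace F]

/-- **Real exponential on a generalized eigenvector of order two**: if `(A − μ)²x = 0` then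
`e^{tA}x = e^{tμ}(x + t(A − μ)x)` (the exponential series truncates; real twin of
`Literature.Analysis.ODE.exp_smul_apply_of_pow_sub_eq_zero` with `k = 2`). [cite: Khalil2002, §4.3 eq. (4.11)] -/
theorem exp_smul_apply_of_sq_sub_eq_zero (A : F →L[ℝ] F) {μ : ℝ} {x : F}
    (hx : (A - μ • (1 : F →L[ℝ] F)) ((A - μ • (1 : F →L[ℝ] F)) x) = 0) (t : ℝ) :
    NormedSpace.exp (t • A) x = Real.exp (t * μ) • (x + t • (A - μ • (1 : F →L[ℝ] F)) x) := by
  set N : F →L[ℝ] F := A - μ • 1 with hN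
  have hsplit : t • A = (t * μ) • (1 : F →L[ℝ] F) + t • N := by
    rw [hN, smul_sub, smul_smul]; module
  have hcomm : Commute ((t * μ) • (1 : F →L[ℝ] F)) (t • N) := ((Commute.one_left _).smul_left _)
  have hscal : NormedSpace.exp ((t * μ) • (1 : F →L[ℝ] F)) = Real.exp (t * μ) • (1 : F →L[ℝ] F) := by
    rw [← Algebra.algebraMap_eq_smul_one, ← NormedSpace.algebraMap_exp_comm,
      Algebra.algebraMap_eq_smul_one, Real.exp_eq_exp_ℝ]
  have hvan : ∀ n, 2 ≤ n → ((t • N) ^ n) x = 0 := by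
    intro n hn
    obtain ⟨m, rfl⟩ := Nat.exists_eq_add_of_le hn
    rw [pow_add, pow_mul_comm]
    change ((t • N) ^ m) (((t • N) ^ 2) x) = 0
    have h2 : ((t • N) ^ 2) x = 0 := by
      rw [pow_two]
      change t • N (t • N x) = 0
      rw [map_smul, hx, smul_zero, smul_zero]
    rw [h2, map_zero]
  have hsum : NormedSpace.exp (t • N) x = x + t • N x := by
    rw [NormedSpace.exp_eq_tsum (𝕂 := ℝ)]
    have hs : Summable fun n : ℕ => ((n.factorial : ℝ)⁻¹) • (t • N) ^ n :=
      NormedSpace.expSeries_summable' (𝕂 := ℝ) _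
    rw [← ContinuousLinearMap.apply_apply x (∑' n, _), ContinuousLinearMap.map_tsum _ hs]
    simp only [ContinuousLinearMap.apply_apply]
    rw [tsum_eq_sum (s := Finset.range 2)]
    · rw [Finset.sum_range_succ, Finset.sum_range_one, pow_zero, pow_one, Nat.factorial_zero, Nat.factorial_one,
        Nat.cast_one, inv_one, one_smul, one_smul]
      rfl
    · intro n hn
      rw [Finset.mem_range, not_lt] at hn
      change (n.factorial : ℝ)⁻¹ • (((t • N) ^ n) x) = 0
      rw [hvan n hn, smul_zero]
  letI : NormedAlgebra ℚ (F →L[ℝ] F) := NormedAlgebra.restrictScalars ℚ ℝ (F →L[ℝ] F)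
  rw [hsplit, NormedSpace.exp_add_of_commute hcomm]
  change NormedSpace.exp ((t * μ) • (1 : F →L[ℝ] F)) (NormedSpace.exp (t • N) x) = _
  rw [hsum, hscal]
  rfl

omit [CompleteSpace F] in
/-- Upper rate on a generalized eigenvector of order two: `‖x + t N x‖ ≤ (1 + t‖N‖)‖x‖` for `t ≥ 0`. [folklore] -/
theorem norm_add_smul_apply_le (N : F →L[ℝ] F) (x : F) {t : ℝ} (ht : 0 ≤ t) :
    ‖x + t • N x‖ ≤ (1 + t * ‖N‖) * ‖x‖ := by
  calc ‖x + t • N x‖ ≤ ‖x‖ + ‖t • N x‖ := norm_add_le _ _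
    _ ≤ ‖x‖ + t * (‖N‖ * ‖x‖) := by
        rw [norm_smul, Real.norm_of_nonneg ht]
        gcongr
        exact N.le_opNorm x
    _ = (1 + t * ‖N‖) * ‖x‖ := by ring

omit [CompleteSpace F] in
/-- Lower rate on a generalized eigenvector of order two: if `N(Nx) = 0` then `‖x‖ ≤ (1 + t‖N‖)‖x + t N x‖` for
`t ≥ 0` (apply `1 − tN` to `x + tNx`). [folklore] -/
theorem norm_le_mul_norm_add_smul_apply (N : F →L[ℝ] F) {x : F} (hx : N (N x) = 0) {t : ℝ} (ht : 0 ≤ t) :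
    ‖x‖ ≤ (1 + t * ‖N‖) * ‖x + t • N x‖ := by
  set y := x + t • N x with hy
  have hNy : N y = N x := by rw [hy, map_add, map_smul, hx, smul_zero, add_zero]
  have hx' : x = y - t • N y := by rw [hNy, hy]; abel
  calc ‖x‖ = ‖y - t • N y‖ := by rw [← hx']
    _ ≤ ‖y‖ + ‖t • N y‖ := norm_sub_le _ _
    _ ≤ ‖y‖ + t * (‖N‖ * ‖y‖) := by
        rw [norm_smul, Real.norm_of_nonneg ht]
        gcongr
        exact N.le_opNorm y
    _ = (1 + t * ‖N‖) * ‖y‖ := by ring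

end OrderTwo

variable {γ : ℝ} {V : EuclideanSpace ℝ (Fin 3) → EuclideanSpace ℝ (Fin 3)}

/-! ### From rates on an invariant splitting to a null trapped set -/

/-- **Rates ⇒ null trapped set.**  `V` smooth with `‖DV‖ ≤ K`, `z ∈ 𝒩_W`; if `A = γI + DV(z)` preserves the
complementary subspaces `Es`, `Ec` (`Ec ≠ ⊤`) and for a sampling time `T > 0` one has `‖e^{TA}x‖ ≤ a‖x‖` on `Es`,
`b‖x‖ ≤ ‖e^{TA}x‖` on `Ec` with `a < 1`, `a < b`, then for some `r > 0` the set of points admitting a `Φ_T`-past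
history inside `B(z, r)` is null (`D(Φ_T)(z) = e^{TA}` and the dominated cone lemma).
[cite: Robinson1999, Ch. V §5.10.1 (cone estimate, dominated form; proved in the tree)] -/
theorem exists_trappedSet_null_of_rates (hV : ContDiff ℝ ∞ V) {K : ℝ} (hK : ∀ y, ‖fderiv ℝ V y‖ ≤ K)
    {z : EuclideanSpace ℝ (Fin 3)} (hz : z ∈ selfSimilarNodalSet γ 0 V)
    {Es Ec : Submodule ℝ (EuclideanSpace ℝ (Fin 3))} (hcompl : IsCompl Es Ec)
    (hs : ∀ x ∈ Es, (γ • ContinuousLinearMap.id ℝ (EuclideanSpace ℝ (Fin 3)) + fderiv ℝ V z) x ∈ Es)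
    (hc : ∀ x ∈ Ec, (γ • ContinuousLinearMap.id ℝ (EuclideanSpace ℝ (Fin 3)) + fderiv ℝ V z) x ∈ Ec)
    (hEc : Ec ≠ ⊤) {T a b : ℝ} (hT : 0 < T) (ha1 : a < 1) (hab : a < b)
    (hcon : ∀ x ∈ Es,
      ‖NormedSpace.exp (T • (γ • ContinuousLinearMap.id ℝ (EuclideanSpace ℝ (Fin 3)) + fderiv ℝ V z)) x‖ ≤ a * ‖x‖)
    (hdom : ∀ x ∈ Ec,
      b * ‖x‖ ≤ ‖NormedSpace.exp (T • (γ • ContinuousLinearMap.id ℝ (EuclideanSpace ℝ (Fin 3)) + fderiv ℝ V z)) x‖) :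
    ∃ T : ℝ, 0 < T ∧ ∃ r : ℝ, 0 < r ∧ volume {q : EuclideanSpace ℝ (Fin 3) | ∃ qs : ℕ → EuclideanSpace ℝ (Fin 3),
      qs 0 = q ∧ (∀ k, ODE.evolutionMap (fun _ : ℝ => selfSimilarTransport γ 0 V) 0 T (qs (k + 1)) = qs k) ∧
        ∀ k, qs k ∈ ball z r} = 0 := by
  set A : EuclideanSpace ℝ (Fin 3) →L[ℝ] EuclideanSpace ℝ (Fin 3) :=
    γ • ContinuousLinearMap.id ℝ (EuclideanSpace ℝ (Fin 3)) + fderiv ℝ V z with hA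
  have hexp := fderiv_flow_eq_exp_smul hV hK hz T
  have hF : ContDiff ℝ 1 (ODE.evolutionMap (fun _ : ℝ => selfSimilarTransport γ 0 V) 0 T) :=
    (contDiff_flow (γ := γ) hV hK T).of_le (by norm_cast)
  obtain ⟨r, hr, hnull⟩ := hausdorffMeasure_localTrappedSet_eq_zero_of_dominated (p := z) hF hcompl
    (fun x hx => by rw [hexp]; exact exp_smul_apply_mem A hs hx T)
    (fun x hx => by rw [hexp]; exact exp_smul_apply_mem A hc hx T) ha1 hab
    (fun x hx => by rw [hexp]; exact hcon x hx) (fun x hx => by rw [hexp]; exact hdom x hx) hEc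
  exact ⟨T, hT, r, hr,
    (Measure.absolutelyContinuous_isAddHaarMeasure volume (μH[Module.finrank ℝ (EuclideanSpace ℝ (Fin 3))])) hnull⟩

/-! ### Two new thin shapes: an eigenvalue meeting a double root (possibly defective) -/

/-- Exponential beats linear: for `κ > 0` and `m ≥ 0` there is `T > 0` with `1 + T m < e^{κ T}`. [folklore] -/
theorem exists_one_add_mul_lt_exp {κ m : ℝ} (hκ : 0 < κ) (hm : 0 ≤ m) :
    ∃ T : ℝ, 0 < T ∧ 1 + T * m < Real.exp (κ * T) := by
  refine ⟨2 * m / κ ^ 2 + 1, by positivity, ?_⟩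
  set T : ℝ := 2 * m / κ ^ 2 + 1 with hT
  have hT0 : 0 < T := by rw [hT]; positivity
  have h1 : 1 + κ * T + (κ * T) ^ 2 / 2 ≤ Real.exp (κ * T) := Real.quadratic_le_exp_of_nonneg (by positivity)
  have h2 : T * m < (κ * T) ^ 2 / 2 := by
    have h3 : κ ^ 2 * T / 2 = m + κ ^ 2 / 2 := by rw [hT]; field_simp
    have h4 : m < κ ^ 2 * T / 2 := by rw [h3]; linarith [pow_pos hκ 2]
    calc T * m < T * (κ ^ 2 * T / 2) := mul_lt_mul_of_pos_left h4 hT0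
      _ = (κ * T) ^ 2 / 2 := by ring
  have h5 : 0 < κ * T := mul_pos hκ hT0
  linarith

/-- **Thin shape «eigenline below a double root».**  `V` smooth with `‖DV‖ ≤ K`, `z ∈ 𝒩_W`, `A = γI + DV(z)`.
Suppose `A v₁ = r₁ v₁` with `v₁ ≠ 0`, `r₁ < 0`, `r₁ < λ₁`, and `(A − r₁)(A − λ₁)² = 0` (the characteristic
polynomial is `(X − r₁)(X − λ₁)²`; the eigenvalue `λ₁` may be DEFECTIVE).  Then for some `T > 0`, `r > 0` the set
of points admitting a `Φ_T`-past history inside `B(z, r)` is null: `Es = ker(A − r₁)` with rate `e^{r₁T}`,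
`Ec = ker(A − λ₁)²` with lower rate `e^{λ₁T}/(1 + T‖A − λ₁‖)` (`e^{TA}x = e^{Tλ₁}(x + T(A − λ₁)x)` there).
[cite: Robinson1999, Ch. V §5.10.1 (cone estimate, dominated form; proved in the tree); Khalil2002, §4.3 eq. (4.11)] -/
theorem exists_trappedSet_null_of_eigenline_lt_doubleRoot (hV : ContDiff ℝ ∞ V) {K : ℝ}
    (hK : ∀ y, ‖fderiv ℝ V y‖ ≤ K) {z : EuclideanSpace ℝ (Fin 3)} (hz : z ∈ selfSimilarNodalSet γ 0 V)
    {r₁ lam₁ : ℝ} {v₁ : EuclideanSpace ℝ (Fin 3)} (hv₁ : v₁ ≠ 0)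
    (hAv₁ : (γ • ContinuousLinearMap.id ℝ (EuclideanSpace ℝ (Fin 3)) + fderiv ℝ V z) v₁ = r₁ • v₁)
    (hr₁ : r₁ < 0) (hr₁lam : r₁ < lam₁)
    (hfac : ∀ x : EuclideanSpace ℝ (Fin 3),
      (γ • ContinuousLinearMap.id ℝ (EuclideanSpace ℝ (Fin 3)) + fderiv ℝ V z)
        (((γ • ContinuousLinearMap.id ℝ (EuclideanSpace ℝ (Fin 3)) + fderiv ℝ V z) - lam₁ • 1)
          (((γ • ContinuousLinearMap.id ℝ (EuclideanSpace ℝ (Fin 3)) + fderiv ℝ V z) - lam₁ • 1) x)) =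
      r₁ • (((γ • ContinuousLinearMap.id ℝ (EuclideanSpace ℝ (Fin 3)) + fderiv ℝ V z) - lam₁ • 1)
          (((γ • ContinuousLinearMap.id ℝ (EuclideanSpace ℝ (Fin 3)) + fderiv ℝ V z) - lam₁ • 1) x))) :
    ∃ T : ℝ, 0 < T ∧ ∃ r : ℝ, 0 < r ∧ volume {q : EuclideanSpace ℝ (Fin 3) | ∃ qs : ℕ → EuclideanSpace ℝ (Fin 3),
      qs 0 = q ∧ (∀ k, ODE.evolutionMap (fun _ : ℝ => selfSimilarTransport γ 0 V) 0 T (qs (k + 1)) = qs k) ∧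
        ∀ k, qs k ∈ ball z r} = 0 := by
  set A : EuclideanSpace ℝ (Fin 3) →L[ℝ] EuclideanSpace ℝ (Fin 3) :=
    γ • ContinuousLinearMap.id ℝ (EuclideanSpace ℝ (Fin 3)) + fderiv ℝ V z with hA
  set M : EuclideanSpace ℝ (Fin 3) →L[ℝ] EuclideanSpace ℝ (Fin 3) := A - lam₁ • 1 with hM
  have hMapp : ∀ x, M x = A x - lam₁ • x := fun x => rfl
  set c : ℝ := (r₁ - lam₁) ^ 2 with hc
  have hc0 : c ≠ 0 := pow_ne_zero 2 (sub_ne_zero.2 (ne_of_lt hr₁lam))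
  -- the splitting
  set Es : Submodule ℝ (EuclideanSpace ℝ (Fin 3)) := LinearMap.ker ((A - r₁ • 1 : EuclideanSpace ℝ (Fin 3) →L[ℝ]
    EuclideanSpace ℝ (Fin 3)) : EuclideanSpace ℝ (Fin 3) →ₗ[ℝ] EuclideanSpace ℝ (Fin 3)) with hEs
  set Ec : Submodule ℝ (EuclideanSpace ℝ (Fin 3)) :=
    LinearMap.ker ((M * M : EuclideanSpace ℝ (Fin 3) →L[ℝ] EuclideanSpace ℝ (Fin 3)) :
      EuclideanSpace ℝ (Fin 3) →ₗ[ℝ] EuclideanSpace ℝ (Fin 3)) with hEc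
  have hmemEs : ∀ x, x ∈ Es ↔ A x = r₁ • x := fun x => by
    rw [hEs, LinearMap.mem_ker]
    change A x - r₁ • x = 0 ↔ _
    rw [sub_eq_zero]
  have hmemEc : ∀ x, x ∈ Ec ↔ M (M x) = 0 := fun x => by rw [hEc, LinearMap.mem_ker]; rfl
  -- `M` on `Es` and `M²` on `M²x`
  have hMEs : ∀ x ∈ Es, M x = (r₁ - lam₁) • x := fun x hx => by
    rw [hMapp, (hmemEs x).1 hx, sub_smul]
  have hMMM : ∀ x, M (M (M (M x))) = c • M (M x) := by
    intro x
    have h1 : M (M (M x)) = (r₁ - lam₁) • M (M x) := by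
      rw [hMapp (M (M x)), hfac x, sub_smul]
    rw [h1, map_smul, h1, smul_smul, hc, sq]
  have hcompl : IsCompl Es Ec := by
    refine isCompl_iff.2 ⟨Submodule.disjoint_def.2 fun x hxs hxc => ?_, codisjoint_iff.2 (Submodule.eq_top_iff'.2 fun x => ?_)⟩
    · have h1 : M (M x) = c • x := by rw [hMEs x hxs, map_smul, hMEs x hxs, smul_smul, hc, sq]
      rw [(hmemEc x).1 hxc] at h1
      exact (smul_eq_zero.1 h1.symm).resolve_left hc0
    · refine Submodule.mem_sup.2 ⟨c⁻¹ • M (M x), ?_, x - c⁻¹ • M (M x), ?_, by abel⟩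
      · rw [hmemEs, map_smul, hfac x, smul_comm]
      · rw [hmemEc, map_sub, map_sub, map_smul, map_smul, hMMM, smul_smul, inv_mul_cancel₀ hc0, one_smul, sub_self]
  have hAM : ∀ x, A (M x) = M (A x) := fun x => by
    rw [hMapp, hMapp, map_sub, map_smul]
  have hs : ∀ x ∈ Es, A x ∈ Es := fun x hx => by
    rw [hmemEs] at hx ⊢; rw [hx, map_smul, hx]
  have hcE : ∀ x ∈ Ec, A x ∈ Ec := fun x hx => by
    rw [hmemEc] at hx ⊢; rw [← hAM, ← hAM, hx, map_zero]
  have hEcne : Ec ≠ ⊤ := by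
    intro htop
    have hv : v₁ ∈ Ec := htop ▸ Submodule.mem_top
    exact hv₁ (Submodule.disjoint_def.1 hcompl.disjoint v₁ ((hmemEs v₁).2 hAv₁) hv)
  -- sampling time
  obtain ⟨T, hT0, hT⟩ := exists_one_add_mul_lt_exp (κ := lam₁ - r₁) (sub_pos.2 hr₁lam) (norm_nonneg M)
  have h1T : 0 < 1 + T * ‖M‖ := by positivity
  refine exists_trappedSet_null_of_rates hV hK hz hcompl hs hcE hEcne hT0 (a := Real.exp (T * r₁))
    (b := Real.exp (T * lam₁) / (1 + T * ‖M‖)) ?_ ?_ (fun x hx => ?_) (fun x hx => ?_)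
  · calc Real.exp (T * r₁) < Real.exp 0 := Real.exp_lt_exp.2 (by nlinarith)
      _ = 1 := Real.exp_zero
  · rw [lt_div_iff₀ h1T]
    calc Real.exp (T * r₁) * (1 + T * ‖M‖) < Real.exp (T * r₁) * Real.exp ((lam₁ - r₁) * T) :=
          mul_lt_mul_of_pos_left hT (Real.exp_pos _)
      _ = Real.exp (T * lam₁) := by rw [← Real.exp_add]; ring_nf
  · -- `e^{TA}x = e^{Tr₁}x` on the eigenline
    have hx' := (hmemEs x).1 hx
    have hsq : (A - r₁ • (1 : EuclideanSpace ℝ (Fin 3) →L[ℝ] EuclideanSpace ℝ (Fin 3)))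
        ((A - r₁ • (1 : EuclideanSpace ℝ (Fin 3) →L[ℝ] EuclideanSpace ℝ (Fin 3))) x) = 0 := by
      have h0 : (A - r₁ • (1 : EuclideanSpace ℝ (Fin 3) →L[ℝ] EuclideanSpace ℝ (Fin 3))) x = 0 := by
        change A x - r₁ • x = 0; rw [hx', sub_self]
      rw [h0, map_zero]
    rw [exp_smul_apply_of_sq_sub_eq_zero A hsq T]
    change ‖Real.exp (T * r₁) • (x + T • (A x - r₁ • x))‖ ≤ _
    rw [hx', sub_self, smul_zero, add_zero, norm_smul, Real.norm_of_nonneg (Real.exp_pos _).le]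
  · -- `e^{TA}x = e^{Tλ₁}(x + TMx)` on `ker M²`
    have hx' := (hmemEc x).1 hx
    rw [exp_smul_apply_of_sq_sub_eq_zero A (μ := lam₁) hx' T, norm_smul, Real.norm_of_nonneg (Real.exp_pos _).le,
      div_mul_eq_mul_div, div_le_iff₀ h1T]
    calc Real.exp (T * lam₁) * ‖x‖ ≤ Real.exp (T * lam₁) * ((1 + T * ‖M‖) * ‖x + T • M x‖) :=
          mul_le_mul_of_nonneg_left (norm_le_mul_norm_add_smul_apply M hx' hT0.le) (Real.exp_pos _).le
      _ = Real.exp (T * lam₁) * ‖x + T • M x‖ * (1 + T * ‖M‖) := by ring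

/-- **Thin shape «double root below an eigenline».**  `V` smooth with `‖DV‖ ≤ K`, `z ∈ 𝒩_W`, `A = γI + DV(z)`.
Suppose `r₁ < 0`, `r₁ < λ₁`, `A ≠ λ₁ I`, and `(A − λ₁)(A − r₁)² = 0` (characteristic polynomial `(X − λ₁)(X − r₁)²`;
the eigenvalue `r₁` may be DEFECTIVE).  Then for some `T > 0`, `r > 0` the set of points admitting a `Φ_T`-past
history inside `B(z, r)` is null: `Es = ker(A − r₁)²` with rate `e^{r₁T}(1 + T‖A − r₁‖)`, `Ec = ker(A − λ₁)` with
rate `e^{λ₁T}`. [cite: Robinson1999, Ch. V §5.10.1 (cone estimate, dominated form; proved in the tree); Khalil2002, §4.3 eq. (4.11)] -/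
theorem exists_trappedSet_null_of_doubleRoot_lt_eigenline (hV : ContDiff ℝ ∞ V) {K : ℝ}
    (hK : ∀ y, ‖fderiv ℝ V y‖ ≤ K) {z : EuclideanSpace ℝ (Fin 3)} (hz : z ∈ selfSimilarNodalSet γ 0 V)
    {r₁ lam₁ : ℝ} (hr₁ : r₁ < 0) (hr₁lam : r₁ < lam₁)
    (hne : ∃ x : EuclideanSpace ℝ (Fin 3),
      (γ • ContinuousLinearMap.id ℝ (EuclideanSpace ℝ (Fin 3)) + fderiv ℝ V z) x ≠ lam₁ • x)
    (hfac : ∀ x : EuclideanSpace ℝ (Fin 3),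
      (γ • ContinuousLinearMap.id ℝ (EuclideanSpace ℝ (Fin 3)) + fderiv ℝ V z)
        (((γ • ContinuousLinearMap.id ℝ (EuclideanSpace ℝ (Fin 3)) + fderiv ℝ V z) - r₁ • 1)
          (((γ • ContinuousLinearMap.id ℝ (EuclideanSpace ℝ (Fin 3)) + fderiv ℝ V z) - r₁ • 1) x)) =
      lam₁ • (((γ • ContinuousLinearMap.id ℝ (EuclideanSpace ℝ (Fin 3)) + fderiv ℝ V z) - r₁ • 1)
          (((γ • ContinuousLinearMap.id ℝ (EuclideanSpace ℝ (Fin 3)) + fderiv ℝ V z) - r₁ • 1) x))) :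
    ∃ T : ℝ, 0 < T ∧ ∃ r : ℝ, 0 < r ∧ volume {q : EuclideanSpace ℝ (Fin 3) | ∃ qs : ℕ → EuclideanSpace ℝ (Fin 3),
      qs 0 = q ∧ (∀ k, ODE.evolutionMap (fun _ : ℝ => selfSimilarTransport γ 0 V) 0 T (qs (k + 1)) = qs k) ∧
        ∀ k, qs k ∈ ball z r} = 0 := by
  set A : EuclideanSpace ℝ (Fin 3) →L[ℝ] EuclideanSpace ℝ (Fin 3) :=
    γ • ContinuousLinearMap.id ℝ (EuclideanSpace ℝ (Fin 3)) + fderiv ℝ V z with hA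
  set M : EuclideanSpace ℝ (Fin 3) →L[ℝ] EuclideanSpace ℝ (Fin 3) := A - r₁ • 1 with hM
  have hMapp : ∀ x, M x = A x - r₁ • x := fun x => rfl
  set c : ℝ := (lam₁ - r₁) ^ 2 with hc
  have hc0 : c ≠ 0 := pow_ne_zero 2 (sub_ne_zero.2 (ne_of_gt hr₁lam))
  set Es : Submodule ℝ (EuclideanSpace ℝ (Fin 3)) :=
    LinearMap.ker ((M * M : EuclideanSpace ℝ (Fin 3) →L[ℝ] EuclideanSpace ℝ (Fin 3)) :
      EuclideanSpace ℝ (Fin 3) →ₗ[ℝ] EuclideanSpace ℝ (Fin 3)) with hEs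
  set Ec : Submodule ℝ (EuclideanSpace ℝ (Fin 3)) := LinearMap.ker ((A - lam₁ • 1 : EuclideanSpace ℝ (Fin 3) →L[ℝ]
    EuclideanSpace ℝ (Fin 3)) : EuclideanSpace ℝ (Fin 3) →ₗ[ℝ] EuclideanSpace ℝ (Fin 3)) with hEc
  have hmemEc : ∀ x, x ∈ Ec ↔ A x = lam₁ • x := fun x => by
    rw [hEc, LinearMap.mem_ker]
    change A x - lam₁ • x = 0 ↔ _
    rw [sub_eq_zero]
  have hmemEs : ∀ x, x ∈ Es ↔ M (M x) = 0 := fun x => by rw [hEs, LinearMap.mem_ker]; rfl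
  have hMEc : ∀ x ∈ Ec, M x = (lam₁ - r₁) • x := fun x hx => by
    rw [hMapp, (hmemEc x).1 hx, sub_smul]
  have hMMM : ∀ x, M (M (M (M x))) = c • M (M x) := by
    intro x
    have h1 : M (M (M x)) = (lam₁ - r₁) • M (M x) := by
      rw [hMapp (M (M x)), hfac x, sub_smul]
    rw [h1, map_smul, h1, smul_smul, hc, sq]
  have hcompl : IsCompl Es Ec := by
    refine isCompl_iff.2 ⟨Submodule.disjoint_def.2 fun x hxs hxc => ?_, codisjoint_iff.2 (Submodule.eq_top_iff'.2 fun x => ?_)⟩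
    · have h1 : M (M x) = c • x := by rw [hMEc x hxc, map_smul, hMEc x hxc, smul_smul, hc, sq]
      rw [(hmemEs x).1 hxs] at h1
      exact (smul_eq_zero.1 h1.symm).resolve_left hc0
    · refine Submodule.mem_sup.2 ⟨x - c⁻¹ • M (M x), ?_, c⁻¹ • M (M x), ?_, by abel⟩
      · rw [hmemEs, map_sub, map_sub, map_smul, map_smul, hMMM, smul_smul, inv_mul_cancel₀ hc0, one_smul, sub_self]
      · rw [hmemEc, map_smul, hfac x, smul_comm]
  have hAM : ∀ x, A (M x) = M (A x) := fun x => by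
    rw [hMapp, hMapp, map_sub, map_smul]
  have hsE : ∀ x ∈ Es, A x ∈ Es := fun x hx => by
    rw [hmemEs] at hx ⊢; rw [← hAM, ← hAM, hx, map_zero]
  have hcE : ∀ x ∈ Ec, A x ∈ Ec := fun x hx => by
    rw [hmemEc] at hx ⊢; rw [hx, map_smul, hx]
  have hEcne : Ec ≠ ⊤ := by
    intro htop
    obtain ⟨x, hx⟩ := hne
    exact hx ((hmemEc x).1 (htop ▸ Submodule.mem_top))
  -- sampling time from `κ = min(−r₁, λ₁ − r₁)`
  set κ : ℝ := min (-r₁) (lam₁ - r₁) with hκ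
  have hκ0 : 0 < κ := lt_min (neg_pos.2 hr₁) (sub_pos.2 hr₁lam)
  obtain ⟨T, hT0, hT⟩ := exists_one_add_mul_lt_exp hκ0 (norm_nonneg M)
  have h1T : 0 < 1 + T * ‖M‖ := by positivity
  have hT1 : 1 + T * ‖M‖ < Real.exp (-r₁ * T) :=
    hT.trans_le (Real.exp_le_exp.2 (mul_le_mul_of_nonneg_right (min_le_left _ _) hT0.le))
  have hT2 : 1 + T * ‖M‖ < Real.exp ((lam₁ - r₁) * T) :=
    hT.trans_le (Real.exp_le_exp.2 (mul_le_mul_of_nonneg_right (min_le_right _ _) hT0.le))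
  refine exists_trappedSet_null_of_rates hV hK hz hcompl hsE hcE hEcne hT0
    (a := Real.exp (T * r₁) * (1 + T * ‖M‖)) (b := Real.exp (T * lam₁)) ?_ ?_ (fun x hx => ?_) (fun x hx => ?_)
  · have h2 : Real.exp (T * r₁) * Real.exp (-r₁ * T) = 1 := by rw [← Real.exp_add]; ring_nf; exact Real.exp_zero
    calc Real.exp (T * r₁) * (1 + T * ‖M‖) < Real.exp (T * r₁) * Real.exp (-r₁ * T) :=
          mul_lt_mul_of_pos_left hT1 (Real.exp_pos _)
      _ = 1 := h2
  · calc Real.exp (T * r₁) * (1 + T * ‖M‖) < Real.exp (T * r₁) * Real.exp ((lam₁ - r₁) * T) :=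
          mul_lt_mul_of_pos_left hT2 (Real.exp_pos _)
      _ = Real.exp (T * lam₁) := by rw [← Real.exp_add]; ring_nf
  · have hx' := (hmemEs x).1 hx
    rw [exp_smul_apply_of_sq_sub_eq_zero A (μ := r₁) hx' T, norm_smul, Real.norm_of_nonneg (Real.exp_pos _).le,
      mul_assoc]
    exact mul_le_mul_of_nonneg_left (norm_add_smul_apply_le M x hT0.le) (Real.exp_pos _).le
  · have hx' := (hmemEc x).1 hx
    have hsq : (A - lam₁ • (1 : EuclideanSpace ℝ (Fin 3) →L[ℝ] EuclideanSpace ℝ (Fin 3)))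
        ((A - lam₁ • (1 : EuclideanSpace ℝ (Fin 3) →L[ℝ] EuclideanSpace ℝ (Fin 3))) x) = 0 := by
      have h0 : (A - lam₁ • (1 : EuclideanSpace ℝ (Fin 3) →L[ℝ] EuclideanSpace ℝ (Fin 3))) x = 0 := by
        change A x - lam₁ • x = 0; rw [hx', sub_self]
      rw [h0, map_zero]
    rw [exp_smul_apply_of_sq_sub_eq_zero A hsq T]
    change _ ≤ ‖Real.exp (T * lam₁) • (x + T • (A x - lam₁ • x))‖
    rw [hx', sub_self, smul_zero, add_zero, norm_smul, Real.norm_of_nonneg (Real.exp_pos _).le]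


end Summit.NavierStokesRegularity.NavierStokesRegularity.Theorems.PowerGaugeEulerLiouville.Kelvin

end
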